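import Literature.AnabelianGeometry.AbsoluteAnabelian.AbsTopIProp410CofinalProofs
import Literature.AnabelianGeometry.AbsoluteAnabelian.AbsTopIProp410iiiAssembly
import Literature.AnabelianGeometry.AbsoluteAnabelian.AbsTopI.CofreeCoreComap
import HarnessLib

/-!
# [AbsTopI] Prop 4.10 (iii), row iii.L04 (compatibility of minimal co-free subgroups along `φ`):
# the inclusion half DISCHARGED, the equality reduced to its residues (proof-only)

S. Mochizuki, *Topics in Absolute Anabelian Geometry I: Generalities* [AbsTopI] (J. Math. Sci.
Univ. Tokyo 19 (2012)), §0 p. 8 and Prop 4.10 (iii) p. 60 / proof p. 61 ("Assertion (iii) follows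
immediately from assertion (i)"; manuscript pagination, lit key `paper:url-11ac98ba15fc`, read on the
page).  Row iii.L04 of the cell's sub-DAG `HOME/plan/L4/SUBDAG-AbsTopI-Prop410.md` (abc-iut-w5-d025,
`AbsTopIProp410Sub.lean` p414417): for a Y-index `H′` (characteristic open of finite index in
`Δ^tp_Y`) and `U := f⁻¹(H′)`, "`f(U^{co-fr}) = H′^{co-fr}`" (`CoFreeCompatAlong`).

* INCLUSION HALF `f(U^{co-fr}) ⊆ H′^{co-fr}` — the hypothesis `hcompat` of abc-iut-L4-t13 gen 4's
  `coFreeCofinalImAlong_right_of` (p424502) — is a THEOREM for every continuous homomorphism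
  (`AbsTopI/CofreeCoreComap.lean`: pull a co-free `K ⊆ H′` back, Nielsen–Schreier).  Hence
  conjunct 2 of `CoFreeCofinalImAlong E` (the direction that DEFINES the comparison map of
  `CoFreeCompletionComparison.lean` and feeds `prop410iiiAt_of_rows`) follows from a profinite
  completion of `Δ^tp_X` with topologically finitely generated target ALONE
  (`coFreeCofinalImAlong_right`, `…_deltaToHat`); the kit-level row iii.L05′
  `CoFreeKernelCofinalAlong` holds at the construction from `CharOpenCofinal X` alone
  (`coFreeKernelCofinalAlong_ofConstruction`).
* EQUALITY.  At the construction `CoFreeCompatAlong` is equivalent to the reverse inclusions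
  `H′^{co-fr} ⊆ f(U^{co-fr})` (`coFreeCompatAlong_ofConstruction_iff`); these follow from the PULLBACK
  FORM `U ∩ f⁻¹(H′^{co-fr}) ⊆ U^{co-fr}` (the honest geometric residue: injectivity of
  `π₁(Γ_{X_U}) → π₁(Γ_{Y_{H′}})`, "filling in one cusp does not change the universal covering of the
  dual graph") together with the IMAGE CLAUSE `H′^{co-fr} ⊆ f(U)`
  (`coFreeCompatAlong_ofConstruction_of_pullback`), and the image clause is NECESSARY
  (`cofreeCore_le_map_of_coFreeCompatAlong`) — it is a SURJECTIVITY-type clause on the tempered `f`,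
  of the kind L4-lead RULING #3f (2026-08-26T02:26Z) set aside for row iii.L03 (print: Def 4.11 (i)(c)
  pp. 62–63 "a dense homomorphism").  The print-supported form of the equality is therefore UP TO
  CLOSURE: pullback form + density of `Δ^tp_X → Δ^tp_Y` + §0 p. 8's standing hypothesis ("admits a
  minimal co-free subgroup", making `H′^{co-fr}` open in `Δ^tp_Y`) ⟹
  `H′^{co-fr} ⊆ closure f(U^{co-fr})` (`cofreeCore_le_closure_map_of_pullback`).

Inputs are hypotheses stated in the signatures (no new named facts; FACT-LIST untouched).
HONEST FRAMING: refereed prerequisite paper; nothing here bears on [IUTchIII] Cor 3.12; typed ≠ proved.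
-/

noncomputable section

open _root_.Topology

namespace Literature.AnabelianGeometry.AbsoluteAnabelian.AbsTopI.Prop410

open Literature.AnabelianGeometry.SemiGraphs
open Literature.AnabelianGeometry.AbsoluteAnabelian.AbsTopI

variable {p : ℕ} [Fact p.Prime]

/-! ### The inclusion half of row iii.L04, discharged -/

namespace DeCuspidalization

variable {X Y : TemperedCurve p} (E : DeCuspidalization X Y)

/-- **Row iii.L04, inclusion half, PROVED**: `f(f⁻¹(H′)^{co-fr}) ⊆ H′^{co-fr}` for EVERY subgroup
`H′ ⊆ Π^tp_Y` (co-free cores; no index hypothesis needed): the hypothesis `hcompat` of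
`coFreeCofinalImAlong_right_of`. [cite: MochizukiAbsTopI2012, Prop 4.10 (iii) p.60] -/
theorem map_cofreeCore_comap_le (H' : Subgroup Y.PiTemp) :
    (cofreeCore (H'.comap E.f.toMonoidHom)).map E.f.toMonoidHom ≤ cofreeCore H' :=
  cofreeCore_map_comap_le E.f H'

/-- The same over the topological-characteristic Y-indices (literally the binder shape of `hcompat`).
[cite: MochizukiAbsTopI2012, Prop 4.10 (iii) p.60] -/
theorem hcompat (H' : CharOpenSubgroup Y.DeltaTemp) :
    (cofreeCore (H'.toSubgroup.comap E.f.toMonoidHom)).map E.f.toMonoidHom ≤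
      cofreeCore H'.toSubgroup :=
  E.map_cofreeCore_comap_le H'.toSubgroup

end DeCuspidalization

/-- **Conjunct 2 of `CoFreeCofinalImAlong E` from a profinite completion of `Δ^tp_X` with
topologically finitely generated target ALONE** (gen 4's `coFreeCofinalImAlong_right_of` with its
row-iii.L04 hypothesis discharged): for every Y-index `H′` an X-index `H` with
`X̂-kernel(H) ≤ Ŷ-kernel(H′)` in `Π̂_Y`. [cite: MochizukiAbsTopI2012, Prop 4.10 (iii) p.60] -/
theorem coFreeCofinalImAlong_right {X Y : TemperedCurve p} (E : DeCuspidalization X Y)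
    {Dhat : Type} [Group Dhat] [TopologicalSpace Dhat] [IsTopologicalGroup Dhat]
    {ι : X.DeltaTemp →ₜ* Dhat} (hι : IsProfiniteCompletion ι)
    (hfg : IsTopologicallyFinitelyGenerated Dhat) (H' : CharOpenSubgroup Y.DeltaTemp) :
    ∃ H : CharOpenSubgroup X.DeltaTemp,
      coFreeKernel (E.fHat.comp X.toHat) H.toSubgroup ≤
        coFreeKernel ((ContinuousMonoidHom.id Y.PiHat).comp Y.toHat) H'.toSubgroup :=
  coFreeCofinalImAlong_right_of E hι hfg E.hcompat H'

/-- The same with L3's own datum `Δ^tp_X → Δ_X` (`TemperedCurve.deltaToHat`) under the hypothesis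
shape `IsProfiniteCompletion X.deltaToHat` of the [SemiAnbd] §6 files, `Δ_X` topologically finitely
generated. [cite: MochizukiAbsTopI2012, Prop 4.10 (iii) p.60] -/
theorem coFreeCofinalImAlong_right_deltaToHat {X Y : TemperedCurve p} (E : DeCuspidalization X Y)
    (hΔ : IsProfiniteCompletion X.deltaToHat) (hfg : IsTopologicallyFinitelyGenerated X.DeltaHat) :
    ∀ H' : CharOpenSubgroup Y.DeltaTemp, ∃ H : CharOpenSubgroup X.DeltaTemp,
      coFreeKernel (E.fHat.comp X.toHat) H.toSubgroup ≤
        coFreeKernel ((ContinuousMonoidHom.id Y.PiHat).comp Y.toHat) H'.toSubgroup :=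
  fun H' => coFreeCofinalImAlong_right E hΔ hfg H'

/-- `CoFreeCofinalImAlong E` therefore reduces to its FIRST conjunct (for every X-index `H` a Y-index
`H′` with `Ŷ-kernel(H′) ≤ X̂-kernel(H)`; EXPECTED-TRUE at genuine data per decider abc-iut-w5-d208,
geometric content) once `Δ^tp_X` has a topologically finitely generated profinite completion.
[cite: MochizukiAbsTopI2012, Prop 4.10 (iii) p.60] -/
theorem coFreeCofinalImAlong_of_left {X Y : TemperedCurve p} (E : DeCuspidalization X Y)
    {Dhat : Type} [Group Dhat] [TopologicalSpace Dhat] [IsTopologicalGroup Dhat]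
    {ι : X.DeltaTemp →ₜ* Dhat} (hι : IsProfiniteCompletion ι)
    (hfg : IsTopologicallyFinitelyGenerated Dhat)
    (hleft : ∀ H : CharOpenSubgroup X.DeltaTemp, ∃ H' : CharOpenSubgroup Y.DeltaTemp,
      coFreeKernel ((ContinuousMonoidHom.id Y.PiHat).comp Y.toHat) H'.toSubgroup ≤
        coFreeKernel (E.fHat.comp X.toHat) H.toSubgroup) :
    CoFreeCofinalImAlong E :=
  ⟨hleft, fun H' => coFreeCofinalImAlong_right E hι hfg H'⟩

/-! ### The kit-level rows at the construction -/

/-- Row iii.L04 AT THE CONSTRUCTION, inclusion half, PROVED: for the kits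
`CoFreeQKit.ofConstruction` (`coFr := cofreeCore`), `f(coFr_X(f⁻¹H′)) ⊆ coFr_Y(H′)` for every `H′`.
[cite: MochizukiAbsTopI2012, Prop 4.10 (iii) p.60] -/
theorem coFreeCompatAlong_le_ofConstruction {X Y : TemperedCurve p} (E : DeCuspidalization X Y)
    (H' : Subgroup Y.PiTemp) :
    ((CoFreeQKit.ofConstruction X Y.PiHat E.fHat).coFr (H'.comap E.f.toMonoidHom)).map
        E.f.toMonoidHom ≤
      (CoFreeQKit.ofConstruction Y Y.PiHat (ContinuousMonoidHom.id Y.PiHat)).coFr H' :=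
  E.map_cofreeCore_comap_le H'

/-- Row iii.L05′ `CoFreeKernelCofinalAlong` needs only the INCLUSION half of iii.L04 (abc-iut-L4-t13
gen 4's `coFreeKernelCofinalAlong_of` rewritten with `≤` in place of `=`): inclusion + monotonicity +
`CharOpenCofinal X` ⟹ for every Y-index `H′` an X-index `H` with
`closure f̂(toHat_X(coFr H)) ⊆ closure toHat_Y(coFr H′)`. [cite: MochizukiAbsTopI2012, §0 p.8] -/
theorem coFreeKernelCofinalAlong_of_le {X Y : TemperedCurve p} {E : DeCuspidalization X Y}
    {kitX : CoFreeQKit X Y.PiHat E.fHat}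
    {kitY : CoFreeQKit Y Y.PiHat (ContinuousMonoidHom.id Y.PiHat)}
    (hle : ∀ H' : Subgroup Y.PiTemp, IsCharOpenFiniteIndexInDelta Y H' →
      (kitX.coFr (H'.comap E.f.toMonoidHom)).map E.f.toMonoidHom ≤ kitY.coFr H')
    (hmono : kitX.Monotone) (hcof : CharOpenCofinal X) :
    CoFreeKernelCofinalAlong E kitX kitY := by
  intro H' hH'
  have hU : IsOpenFiniteIndexInDelta X (H'.comap E.f.toMonoidHom) :=
    E.isOpenFiniteIndexInDelta_comap hH'.1
  obtain ⟨H, hH, hHU⟩ := hcof _ hU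
  refine ⟨H, hH, ?_⟩
  have hle' : kitX.coFr H ≤ kitX.coFr (H'.comap E.f.toMonoidHom) := hmono H _ hH.1 hU hHU
  have hmap : (kitX.coFr H).map (E.fHat.toMonoidHom.comp X.toHat.toMonoidHom) ≤
      (kitY.coFr H').map Y.toHat.toMonoidHom := by
    rw [← E.toHat_comp_eq, ← Subgroup.map_map]
    exact Subgroup.map_mono ((Subgroup.map_mono hle').trans (hle H' hH'))
  exact Subgroup.topologicalClosure_mono hmap

/-- **Row iii.L05′ `CoFreeKernelCofinalAlong` AT THE CONSTRUCTION from `CharOpenCofinal X` alone**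
(inclusion half of iii.L04 and monotonicity are theorems there). [cite: MochizukiAbsTopI2012, §0 p.8] -/
theorem coFreeKernelCofinalAlong_ofConstruction {X Y : TemperedCurve p} (E : DeCuspidalization X Y)
    (hcof : CharOpenCofinal X) :
    CoFreeKernelCofinalAlong E (CoFreeQKit.ofConstruction X Y.PiHat E.fHat)
      (CoFreeQKit.ofConstruction Y Y.PiHat (ContinuousMonoidHom.id Y.PiHat)) :=
  coFreeKernelCofinalAlong_of_le (fun H' _ => coFreeCompatAlong_le_ofConstruction E H')
    (fun _ _ _ _ h => CoFreeQKit.coFr_mono_ofConstruction X Y.PiHat E.fHat h) hcof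

/-! ### The equality: what it is equivalent to, what it needs, what print supports -/

/-- **Row iii.L04 AT THE CONSTRUCTION is equivalent to the reverse inclusions**
`H′^{co-fr} ⊆ f(f⁻¹(H′)^{co-fr})` over the Y-indices (the inclusion half being a theorem).
[cite: MochizukiAbsTopI2012, Prop 4.10 (iii) p.60] -/
theorem coFreeCompatAlong_ofConstruction_iff {X Y : TemperedCurve p} (E : DeCuspidalization X Y) :
    CoFreeCompatAlong E (CoFreeQKit.ofConstruction X Y.PiHat E.fHat)
        (CoFreeQKit.ofConstruction Y Y.PiHat (ContinuousMonoidHom.id Y.PiHat)) ↔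
      ∀ H' : Subgroup Y.PiTemp, IsCharOpenFiniteIndexInDelta Y H' →
        cofreeCore H' ≤ (cofreeCore (H'.comap E.f.toMonoidHom)).map E.f.toMonoidHom := by
  constructor
  · intro h H' hH'
    exact (h H' hH').symm.le
  · intro h H' hH'
    exact le_antisymm (E.map_cofreeCore_comap_le H') (h H' hH')

/-- **Row iii.L04 AT THE CONSTRUCTION from its two residues**: the PULLBACK FORM
`f⁻¹(H′) ∩ f⁻¹(H′^{co-fr}) ⊆ f⁻¹(H′)^{co-fr}` (geometric: injectivity on dual-graph fundamental groups)
and the IMAGE CLAUSE `H′^{co-fr} ⊆ f(f⁻¹(H′))` (surjectivity-type), for every Y-index `H′`.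
[cite: MochizukiAbsTopI2012, Prop 4.10 (iii) p.60] -/
theorem coFreeCompatAlong_ofConstruction_of_pullback {X Y : TemperedCurve p} (E : DeCuspidalization X Y)
    (hpull : ∀ H' : Subgroup Y.PiTemp, IsCharOpenFiniteIndexInDelta Y H' →
      H'.comap E.f.toMonoidHom ⊓ (cofreeCore H').comap E.f.toMonoidHom ≤
        cofreeCore (H'.comap E.f.toMonoidHom))
    (himg : ∀ H' : Subgroup Y.PiTemp, IsCharOpenFiniteIndexInDelta Y H' →
      cofreeCore H' ≤ (H'.comap E.f.toMonoidHom).map E.f.toMonoidHom) :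
    CoFreeCompatAlong E (CoFreeQKit.ofConstruction X Y.PiHat E.fHat)
      (CoFreeQKit.ofConstruction Y Y.PiHat (ContinuousMonoidHom.id Y.PiHat)) :=
  fun H' hH' => map_cofreeCore_comap_eq_of_pullback_of_le_map E.f H' (hpull H' hH') (himg H' hH')

/-- **The image clause is NECESSARY** for row iii.L04 as typed: `CoFreeCompatAlong` at the construction
forces `H′^{co-fr} ⊆ f(f⁻¹(H′)) ⊆ f(Π^tp_X)` for every Y-index — a surjectivity-type property of the
tempered `f` (cf. L4-lead RULING #3f on row iii.L03: print, Def 4.11 (i)(c), has `f` DENSE).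
[cite: MochizukiAbsTopI2012, Prop 4.10 (iii) p.60] -/
theorem cofreeCore_le_map_of_coFreeCompatAlong {X Y : TemperedCurve p} (E : DeCuspidalization X Y)
    (h : CoFreeCompatAlong E (CoFreeQKit.ofConstruction X Y.PiHat E.fHat)
      (CoFreeQKit.ofConstruction Y Y.PiHat (ContinuousMonoidHom.id Y.PiHat)))
    {H' : Subgroup Y.PiTemp} (hH' : IsCharOpenFiniteIndexInDelta Y H') :
    cofreeCore H' ≤ (H'.comap E.f.toMonoidHom).map E.f.toMonoidHom :=
  cofreeCore_le_map_comap_of_map_eq E.f H' (h H' hH')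

/-- Under row iii.L04 as typed, the pullback form is EQUIVALENT to the kernel clause
`Ker f ∩ f⁻¹(H′) ⊆ f⁻¹(H′)^{co-fr}` ("the inertia of the filled cusp dies in `π₁` of the dual graph").
[cite: MochizukiAbsTopI2012, Prop 4.10 (iii) p.60] -/
theorem pullback_iff_ker_le_of_coFreeCompatAlong {X Y : TemperedCurve p} (E : DeCuspidalization X Y)
    (h : CoFreeCompatAlong E (CoFreeQKit.ofConstruction X Y.PiHat E.fHat)
      (CoFreeQKit.ofConstruction Y Y.PiHat (ContinuousMonoidHom.id Y.PiHat)))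
    {H' : Subgroup Y.PiTemp} (hH' : IsCharOpenFiniteIndexInDelta Y H') :
    H'.comap E.f.toMonoidHom ⊓ (cofreeCore H').comap E.f.toMonoidHom ≤
        cofreeCore (H'.comap E.f.toMonoidHom) ↔
      E.f.toMonoidHom.ker ⊓ H'.comap E.f.toMonoidHom ≤ cofreeCore (H'.comap E.f.toMonoidHom) :=
  ⟨ker_inf_comap_le_cofreeCore_of_pullback E.f H',
    pullback_of_map_eq_of_ker_le E.f H' (h H' hH')⟩

/-- **What print supports — the equality UP TO CLOSURE**: the pullback form for `H′`, DENSITY of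
`Δ^tp_X → Δ^tp_Y` ([AbsTopI] Def 4.11 (i)(c), Δ-level; forced by the node "(iii) for `Δ^tp`",
`Prop410iiiDelta.denseRange_fDelta`) and §0 p. 8's standing hypothesis for `H′` ("admits a minimal
co-free subgroup", so `H′^{co-fr}` is OPEN in `Δ^tp_Y`) ⟹ `H′^{co-fr} ⊆ closure f(f⁻¹(H′)^{co-fr})`:
every element of the open `H′^{co-fr} ⊆ Δ^tp_Y` is a limit of images `f(d)`, `d ∈ Δ^tp_X`, lying in
`H′^{co-fr}`, and such a `d` lies in `f⁻¹(H′)^{co-fr}` by the pullback form.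
[cite: MochizukiAbsTopI2012, Prop 4.10 (iii) p.60] -/
theorem cofreeCore_le_closure_map_of_pullback {X Y : TemperedCurve p} (E : DeCuspidalization X Y)
    (H' : CharOpenSubgroup Y.DeltaTemp)
    (hpull : H'.toSubgroup.comap E.f.toMonoidHom ⊓ (cofreeCore H'.toSubgroup).comap E.f.toMonoidHom ≤
      cofreeCore (H'.toSubgroup.comap E.f.toMonoidHom))
    (hdense : DenseRange E.fDelta) {M : Subgroup Y.PiTemp} (hM : IsMinimalCofreeIn H'.toSubgroup M) :
    cofreeCore H'.toSubgroup ≤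
      ((cofreeCore (H'.toSubgroup.comap E.f.toMonoidHom)).map E.f.toMonoidHom).topologicalClosure := by
  intro y hy
  have hyΔ : y ∈ Y.DeltaTemp := H'.le (cofreeCore_le _ hy)
  -- the open subgroup `H′^{co-fr} ∩ Δ^tp_Y` of `Δ^tp_Y`
  have hopen : IsOpen (((cofreeCore H'.toSubgroup).subgroupOf Y.DeltaTemp : Subgroup Y.DeltaTemp) :
      Set Y.DeltaTemp) := isOpen_cofreeCore_subgroupOf H' hM
  change y ∈ closure _
  rw [mem_closure_iff]
  intro O hO hyO
  -- `O ∩ H′^{co-fr}`, read in `Δ^tp_Y`, is open and contains `y`; density gives `f(d)` in it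
  have hV : IsOpen ((Subtype.val ⁻¹' O : Set Y.DeltaTemp) ∩
      (((cofreeCore H'.toSubgroup).subgroupOf Y.DeltaTemp : Subgroup Y.DeltaTemp) : Set Y.DeltaTemp)) :=
    (hO.preimage continuous_subtype_val).inter hopen
  have hne : ((Subtype.val ⁻¹' O : Set Y.DeltaTemp) ∩
      (((cofreeCore H'.toSubgroup).subgroupOf Y.DeltaTemp : Subgroup Y.DeltaTemp) :
        Set Y.DeltaTemp)).Nonempty :=
    ⟨⟨y, hyΔ⟩, hyO, Subgroup.mem_subgroupOf.mpr hy⟩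
  obtain ⟨d, hdO, hdM⟩ := hdense.exists_mem_open hV hne
  have hfd : E.f (d : X.PiTemp) ∈ cofreeCore H'.toSubgroup := Subgroup.mem_subgroupOf.mp hdM
  refine ⟨E.f (d : X.PiTemp), hdO, ?_⟩
  -- `d ∈ f⁻¹(H′) ∩ f⁻¹(H′^{co-fr}) ⊆ f⁻¹(H′)^{co-fr}` by the pullback form
  have hd : (d : X.PiTemp) ∈ cofreeCore (H'.toSubgroup.comap E.f.toMonoidHom) :=
    hpull (Subgroup.mem_inf.mpr
      ⟨Subgroup.mem_comap.mpr (cofreeCore_le _ hfd), Subgroup.mem_comap.mpr hfd⟩)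
  exact ⟨(d : X.PiTemp), hd, rfl⟩

end Literature.AnabelianGeometry.AbsoluteAnabelian.AbsTopI.Prop410

end
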